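import Summits.NavierStokesRegularity.NavierStokesRegularity.Theorems.AxisymmetricExtremalityAxisymmetricKatoGlobalStubSeregin2020TypeIILemma22LevelSetSlices
import Summits.NavierStokesRegularity.NavierStokesRegularity.Theorems.AxisTwistDoorAveragedConeLiouvilleNUIsoperimetricLip
import HarnessLib

/-!
# AxisTwistDoorAveragedConeLiouvilleNUShrinkingLevelsLip — Nazarov–Uraltseva 2012 Lemma 3.3 (shrinking
# levels), measure-theoretic core for LIPSCHITZ slices (toward T1 piece L33ᴸ `Sig.nuLip_shrinking`,
# kit `pub/ns-inputs/kits/N4-T1-skeleton.lean` sha16 `118454bf17607d1e`)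

Seat ns-qj-p1 g3 (plan g6 key 13:35:09Z / director KEY-NS #145), `--supports stmt-NavierStokesRegularity-26889
--as helper`. The Lipschitz-slice twin of the tree's `shrinkingLevels_sq_mul_le` / `shrinkingLevels_measure_le`
(`…Lemma22ShrinkingLevels.lean`, ns `…AxisymmetricKatoGlobal.EulerScaling`; slices `C¹` off the axis): the SAME
statements and the SAME proofs with the slice hypothesis `∀ᵐ t, ContDiffOn ℝ 1 (Φ t) (B ∩ {r ≠ 0})` replaced
by «every slice is `L`-Lipschitz» and the one use of De Giorgi's isoperimetric inequality
(`deGiorgi_isoperimetric_ball_offAxis`) replaced by ns-in-ser-a g2's Lipschitz version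
`NU.deGiorgi_isoperimetric_ball_fin_three_of_lipschitzWith` (p637969; same constant `64π/3 · R⁴`, same open
band, `fderiv` the a.e. derivative); slice measurability is now continuity.

* `shrinkingLevels_sq_mul_le_of_lipschitz` — `s · |Q ∩ {Φ < k₀/2^{s+1}}|² ≤ (4 C_DG² C R⁵/(δ₁²|B₁|²)) |Q|`;
* `shrinkingLevels_measure_le_of_lipschitz` — hence `|Q ∩ {Φ < k₀/2^{s+1}}| ≤ μ |Q|` for `s` large (explicit).

An INPUT tool (N4/T1 Lipschitz port of the N–U De Giorgi chain); no Navier–Stokes statement is touched; item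
26889 and the summit stay OPEN. [cite: NazarovUraltseva2012, Lemma 3.3 and its proof, (3.11)–(3.12)]
[cite: CaffarelliVasseur2010DeGiorgiSurvey, Lemma 1.4]
-/

-- the problem directory repeats the summit name (D-0017); core's `dupNamespace` linter fires
set_option linter.dupNamespace false

noncomputable section

open MeasureTheory Set Function Filter Topology Metric Module
open scoped NNReal ENNReal

namespace Summit.NavierStokesRegularity.NavierStokesRegularity.Theorems.AveragedConeLiouville.NU

open Literature.Analysis.FluidPDE
open Summit.NavierStokesRegularity.NavierStokesRegularity.Theorems.AxisymmetricKatoGlobal.EulerScaling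

/-- **Nazarov–Uraltseva 2012, Lemma 3.3 (shrinking levels), measure-theoretic core,
quantitative form.** Let `Q = I × B_R(x₀)`, `I = ]a, b[`, and let `Φ` be a.e.-measurable on
`Q` with a.e.-measurable gradient there, every slice `Φ(t, ·)` being `L`-Lipschitz (in place of `C¹` off the symmetry axis, the class 𝒱 of
Seregin's Lemma 2.2). Assume (3.11)
`|B_R ∩ {Φ(t,·) ≥ k₀}| ≥ δ₁ |B_R|` for all `t ∈ I` and the energy bounds (3.12)
`∫∫_{Q ∩ {Φ < k_m}} |∇Φ|² ≤ C k_m² R³`, `k_m = k₀ / 2^m`, for all `m ≥ 1` (levels `≤ k₀/2`: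
the energy inequality behind (3.12) is available in the class 𝒱 only for test profiles vanishing
at the axis level, N–U Remark 9). Then for every `s`,
`s · |Q ∩ {Φ < k_{s+1}}|² ≤ (4 C_DG² C R⁵ / (δ₁² |B₁|²)) · |Q|` with `C_DG = 64π/3` the constant of
`NU.deGiorgi_isoperimetric_ball_fin_three_of_lipschitzWith` (proof: De Giorgi's inequality on each slice between the
levels `k_{m+1} < k_m`, integration in time, Cauchy–Schwarz on the band
`𝓔_m = Q ∩ {k_{m+1} < Φ < k_m}`, and `Σ_m |𝓔_m| ≤ |Q|`).
[cite: NazarovUraltseva2012, Lemma 3.3 and its proof, (3.11)–(3.12); Seregin2020, Lemma 2.2] -/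
theorem shrinkingLevels_sq_mul_le_of_lipschitz
    (Φ : ℝ → EuclideanSpace ℝ (Fin 3) → ℝ) (x₀ : EuclideanSpace ℝ (Fin 3))
    (R a b k₀ δ₁ C : ℝ) (hR : 0 < R) (hk₀ : 0 < k₀) (hδ₁ : 0 < δ₁) (hC : 0 ≤ C)
    (hΦm : AEStronglyMeasurable (uncurry Φ) (volume.restrict (Ioo a b ×ˢ ball x₀ R)))
    (hDm : AEStronglyMeasurable (fun z : ℝ × EuclideanSpace ℝ (Fin 3) => fderiv ℝ (Φ z.1) z.2)
      (volume.restrict (Ioo a b ×ˢ ball x₀ R)))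
    {L : ℝ≥0} (hLip : ∀ t, LipschitzWith L (Φ t))
    (hδ : ∀ᵐ t ∂(volume.restrict (Ioo a b)), ENNReal.ofReal δ₁ * volume (ball x₀ R) ≤
      volume (ball x₀ R ∩ {x | k₀ ≤ Φ t x}))
    (hE : ∀ m : ℕ, 1 ≤ m → ∫⁻ z in (Ioo a b ×ˢ ball x₀ R) ∩ {z | Φ z.1 z.2 < k₀ / 2 ^ m},
        ‖fderiv ℝ (Φ z.1) z.2‖ₑ ^ 2 ≤ ENNReal.ofReal (C * (k₀ / 2 ^ m) ^ 2 * R ^ 3))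
    (s : ℕ) :
    (s : ℝ) * (volume ((Ioo a b ×ˢ ball x₀ R) ∩
        {z | Φ z.1 z.2 < k₀ / 2 ^ (s + 1)})).toReal ^ 2 ≤
      4 * (64 * Real.pi / 3) ^ 2 * C * R ^ 5 /
          (δ₁ ^ 2 * (volume (ball (0 : EuclideanSpace ℝ (Fin 3)) 1)).toReal ^ 2) *
        (volume (Ioo a b ×ˢ ball x₀ R)).toReal := by
  -- ### notation and elementary facts
  set B : Set (EuclideanSpace ℝ (Fin 3)) := ball x₀ R with hB
  set I : Set ℝ := Ioo a b with hI
  set Q : Set (ℝ × EuclideanSpace ℝ (Fin 3)) := I ×ˢ B with hQ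
  set V₁ : ℝ := (volume (ball (0 : EuclideanSpace ℝ (Fin 3)) 1)).toReal with hV₁
  set CDG : ℝ := 64 * Real.pi / 3 with hCDG
  have hBvol : volume B = ENNReal.ofReal (R ^ 3) * volume (ball (0 : EuclideanSpace ℝ (Fin 3)) 1) := by
    rw [hB, Measure.addHaar_ball_of_pos volume x₀ hR, finrank_euclideanSpace_fin]
  have hB1pos : 0 < volume (ball (0 : EuclideanSpace ℝ (Fin 3)) 1) := measure_ball_pos _ _ one_pos
  have hB1fin : volume (ball (0 : EuclideanSpace ℝ (Fin 3)) 1) < ∞ := measure_ball_lt_top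
  have hV₁pos : 0 < V₁ := ENNReal.toReal_pos hB1pos.ne' hB1fin.ne
  have hBfin : volume B < ∞ := measure_ball_lt_top
  have hBreal : (volume B).toReal = R ^ 3 * V₁ := by
    rw [hBvol, ENNReal.toReal_mul, ENNReal.toReal_ofReal (by positivity), hV₁]
  have hQvol : volume Q = volume I * volume B := by
    rw [hQ, Measure.volume_eq_prod, Measure.prod_prod]
  have hIfin : volume I < ∞ := by rw [hI]; exact measure_Ioo_lt_top
  have hQfin : volume Q < ∞ := by rw [hQvol]; exact ENNReal.mul_lt_top hIfin hBfin
  have hQfin' : ∀ A : Set (ℝ × EuclideanSpace ℝ (Fin 3)), volume (Q ∩ A) < ∞ := fun A =>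
    (measure_mono inter_subset_left).trans_lt hQfin
  have hΦm' : AEMeasurable (uncurry Φ) (volume.restrict Q) := hΦm.aemeasurable
  have hsl : ∀ᵐ t ∂(volume.restrict I), AEMeasurable (Φ t) (volume.restrict B) := by
    exact Eventually.of_forall fun t => (hLip t).continuous.aemeasurable
  have hGm : AEMeasurable (fun z : ℝ × EuclideanSpace ℝ (Fin 3) => ‖fderiv ℝ (Φ z.1) z.2‖ₑ)
      (volume.restrict Q) := hDm.enorm
  -- the levels `k m = k₀ / 2^m`
  set k : ℕ → ℝ := fun m => k₀ / 2 ^ m with hk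
  have hkpos : ∀ m, 0 < k m := fun m => by rw [hk]; positivity
  have hksucc : ∀ m, k (m + 1) = k m / 2 := fun m => by
    simp only [hk, pow_succ]; ring
  have hkanti : ∀ {m n : ℕ}, m ≤ n → k n ≤ k m := fun {m n} hmn => by
    simp only [hk]
    exact div_le_div_of_nonneg_left hk₀.le (by positivity)
      (pow_le_pow_right₀ (by norm_num) hmn)
  have hkle : ∀ m, k m ≤ k₀ := fun m => by
    have h := hkanti (Nat.zero_le m)
    simpa [hk] using h
  -- the sets
  set A : ℕ → Set (ℝ × EuclideanSpace ℝ (Fin 3)) := fun m => Q ∩ {z | Φ z.1 z.2 ≤ k m} with hA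
  set E : ℕ → Set (ℝ × EuclideanSpace ℝ (Fin 3)) :=
    fun m => Q ∩ {z | k (m + 1) < Φ z.1 z.2 ∧ Φ z.1 z.2 < k m} with hE'
  -- ### the per-level inequality `|A_{m+1}|² ≤ K² |E_m|`
  set K2 : ℝ := 4 * CDG ^ 2 * C * R ^ 5 / (δ₁ ^ 2 * V₁ ^ 2) with hK2
  have hK2nn : 0 ≤ K2 := by rw [hK2]; positivity
  have key : ∀ m : ℕ, 1 ≤ m →
      (volume (A (m + 1))).toReal ^ 2 ≤ K2 * (volume (E m)).toReal := by
    intro m hm1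
    set l : ℝ := k m with hl
    set c : ℝ := k (m + 1) with hc
    have hlpos : 0 < l := hkpos m
    have hcl : c < l := by rw [hc, hksucc, hl]; linarith [hkpos m]
    have hlc : l - c = l / 2 := by rw [hc, hksucc, hl]; ring
    -- (a) De Giorgi on the slices, with (3.11)
    have hslice : ∀ᵐ t ∂(volume.restrict I),
        ENNReal.ofReal (l - c) * ENNReal.ofReal δ₁ * volume B *
            volume (B ∩ {x | Φ t x ≤ c}) ≤
          ENNReal.ofReal (CDG * R ^ 4) *
            ∫⁻ x in B ∩ {x | c < Φ t x ∧ Φ t x < l}, ‖fderiv ℝ (Φ t) x‖ₑ := by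
      filter_upwards [hδ] with t hδt
      have hDG := deGiorgi_isoperimetric_ball_fin_three_of_lipschitzWith (hLip t) x₀ R hcl
      have hlow : ENNReal.ofReal δ₁ * volume B ≤ volume (B ∩ {x | l ≤ Φ t x}) :=
        hδt.trans (measure_mono fun x hx => ⟨hx.1, (hkle m).trans hx.2⟩)
      calc ENNReal.ofReal (l - c) * ENNReal.ofReal δ₁ * volume B * volume (B ∩ {x | Φ t x ≤ c})
          = ENNReal.ofReal (l - c) * volume (B ∩ {x | Φ t x ≤ c}) *
              (ENNReal.ofReal δ₁ * volume B) := by ring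
        _ ≤ ENNReal.ofReal (l - c) * volume (B ∩ {x | Φ t x ≤ c}) *
              volume (B ∩ {x | l ≤ Φ t x}) := by gcongr
        _ ≤ ENNReal.ofReal (CDG * R ^ 4) *
              ∫⁻ x in B ∩ {x | c < Φ t x ∧ Φ t x < l}, ‖fderiv ℝ (Φ t) x‖ₑ := by
            simpa only [hCDG] using hDG
    -- (b) integrate in time
    have hfin3 : ENNReal.ofReal (l - c) * ENNReal.ofReal δ₁ * volume B ≠ ∞ :=
      ENNReal.mul_ne_top (ENNReal.mul_ne_top ENNReal.ofReal_ne_top ENNReal.ofReal_ne_top)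
        hBfin.ne
    have hint : ENNReal.ofReal (l - c) * ENNReal.ofReal δ₁ * volume B *
          ∫⁻ t in I, volume (B ∩ {x | Φ t x ≤ c}) ≤
        ENNReal.ofReal (CDG * R ^ 4) *
          ∫⁻ t in I, ∫⁻ x in B ∩ {x | c < Φ t x ∧ Φ t x < l}, ‖fderiv ℝ (Φ t) x‖ₑ := by
      calc ENNReal.ofReal (l - c) * ENNReal.ofReal δ₁ * volume B *
            ∫⁻ t in I, volume (B ∩ {x | Φ t x ≤ c})
          = ∫⁻ t in I, ENNReal.ofReal (l - c) * ENNReal.ofReal δ₁ * volume B *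
              volume (B ∩ {x | Φ t x ≤ c}) := by
            rw [lintegral_const_mul' _ _ hfin3]
        _ ≤ ∫⁻ t in I, ENNReal.ofReal (CDG * R ^ 4) *
              ∫⁻ x in B ∩ {x | c < Φ t x ∧ Φ t x < l}, ‖fderiv ℝ (Φ t) x‖ₑ := by
            exact lintegral_mono_ae hslice
        _ = ENNReal.ofReal (CDG * R ^ 4) *
              ∫⁻ t in I, ∫⁻ x in B ∩ {x | c < Φ t x ∧ Φ t x < l}, ‖fderiv ℝ (Φ t) x‖ₑ := by
            rw [lintegral_const_mul' _ _ ENNReal.ofReal_ne_top]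
    -- (c) Tonelli: the two time integrals are `|A_{m+1}|` and `∫∫_{E_m} |∇Φ|`
    have hTA : ∫⁻ t in I, volume (B ∩ {x | Φ t x ≤ c}) = volume (A (m + 1)) := by
      have h := volume_inter_levelSet_eq_lintegral_slices hΦm' hsl
        (T := Iic c) measurableSet_Iic
      simpa only [mem_Iic] using h.symm
    have hTE : ∫⁻ t in I, ∫⁻ x in B ∩ {x | c < Φ t x ∧ Φ t x < l}, ‖fderiv ℝ (Φ t) x‖ₑ =
        ∫⁻ z in E m, ‖fderiv ℝ (Φ z.1) z.2‖ₑ := by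
      have h := lintegral_inter_levelSet_eq_lintegral_slices hΦm' hsl
        (T := Ioo c l) measurableSet_Ioo hGm
      simpa only [mem_Ioo] using h.symm
    rw [hTA, hTE] at hint
    -- (d) Cauchy–Schwarz on the band and the energy bound (3.12)
    have hEsub : E m ⊆ Q ∩ {z | Φ z.1 z.2 < k₀ / 2 ^ m} := fun z hz => ⟨hz.1, hz.2.2⟩
    have hEsubQ : E m ⊆ Q := inter_subset_left
    have hGmE : AEMeasurable (fun z : ℝ × EuclideanSpace ℝ (Fin 3) => ‖fderiv ℝ (Φ z.1) z.2‖ₑ)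
        (volume.restrict (E m)) :=
      hGm.mono_measure (Measure.restrict_mono hEsubQ le_rfl)
    have hCS : ∫⁻ z in E m, ‖fderiv ℝ (Φ z.1) z.2‖ₑ ≤
        (ENNReal.ofReal (C * l ^ 2 * R ^ 3)) ^ (1 / 2 : ℝ) * (volume (E m)) ^ (1 / 2 : ℝ) := by
      have hH := ENNReal.lintegral_mul_le_Lp_mul_Lq (volume.restrict (E m))
        Real.HolderConjugate.two_two hGmE aemeasurable_const (g := fun _ => (1 : ℝ≥0∞))
      simp only [Pi.mul_apply, mul_one, ENNReal.one_rpow, setLIntegral_one] at hH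
      have e3 : ∫⁻ z in E m, ‖fderiv ℝ (Φ z.1) z.2‖ₑ ^ (2 : ℝ) ≤
          ENNReal.ofReal (C * l ^ 2 * R ^ 3) := by
        calc ∫⁻ z in E m, ‖fderiv ℝ (Φ z.1) z.2‖ₑ ^ (2 : ℝ)
            = ∫⁻ z in E m, ‖fderiv ℝ (Φ z.1) z.2‖ₑ ^ 2 := by
                refine lintegral_congr fun z => ?_
                rw [show (2 : ℝ) = ((2 : ℕ) : ℝ) by norm_num, ENNReal.rpow_natCast]
          _ ≤ ∫⁻ z in Q ∩ {z | Φ z.1 z.2 < k₀ / 2 ^ m}, ‖fderiv ℝ (Φ z.1) z.2‖ₑ ^ 2 :=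
                lintegral_mono_set hEsub
          _ ≤ ENNReal.ofReal (C * l ^ 2 * R ^ 3) := hE m hm1
      exact hH.trans (mul_le_mul' (ENNReal.rpow_le_rpow e3 (by norm_num)) le_rfl)
    -- (e) combine and pass to real numbers
    have hcomb : ENNReal.ofReal (l - c) * ENNReal.ofReal δ₁ * volume B * volume (A (m + 1)) ≤
        ENNReal.ofReal (CDG * R ^ 4) *
          ((ENNReal.ofReal (C * l ^ 2 * R ^ 3)) ^ (1 / 2 : ℝ) * (volume (E m)) ^ (1 / 2 : ℝ)) :=
      hint.trans (mul_le_mul' le_rfl hCS)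
    have hEfin : volume (E m) < ∞ := hQfin' _
    have hAfin : volume (A (m + 1)) < ∞ := hQfin' _
    have hRHSfin : ENNReal.ofReal (CDG * R ^ 4) *
        ((ENNReal.ofReal (C * l ^ 2 * R ^ 3)) ^ (1 / 2 : ℝ) * (volume (E m)) ^ (1 / 2 : ℝ)) ≠ ∞ := by
      refine ENNReal.mul_ne_top ENNReal.ofReal_ne_top (ENNReal.mul_ne_top ?_ ?_)
      · exact (ENNReal.rpow_lt_top_of_nonneg (by norm_num) ENNReal.ofReal_ne_top).ne
      · exact (ENNReal.rpow_lt_top_of_nonneg (by norm_num) hEfin.ne).ne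
    have hreal := ENNReal.toReal_mono hRHSfin hcomb
    set Av : ℝ := (volume (A (m + 1))).toReal with hAv
    set Ev : ℝ := (volume (E m)).toReal with hEv
    have hAv0 : 0 ≤ Av := ENNReal.toReal_nonneg
    have hEv0 : 0 ≤ Ev := ENNReal.toReal_nonneg
    have eL : (ENNReal.ofReal (l - c) * ENNReal.ofReal δ₁ * volume B *
        volume (A (m + 1))).toReal = (l - c) * δ₁ * (R ^ 3 * V₁) * Av := by
      rw [ENNReal.toReal_mul, ENNReal.toReal_mul, ENNReal.toReal_mul,
        ENNReal.toReal_ofReal (by linarith), ENNReal.toReal_ofReal hδ₁.le, hBreal]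
    have eR : (ENNReal.ofReal (CDG * R ^ 4) *
        ((ENNReal.ofReal (C * l ^ 2 * R ^ 3)) ^ (1 / 2 : ℝ) * (volume (E m)) ^ (1 / 2 : ℝ))).toReal =
          CDG * R ^ 4 * ((C * l ^ 2 * R ^ 3) ^ (1 / 2 : ℝ) * Ev ^ (1 / 2 : ℝ)) := by
      rw [ENNReal.toReal_mul, ENNReal.toReal_mul, ENNReal.toReal_ofReal (by positivity),
        ← ENNReal.toReal_rpow, ← ENNReal.toReal_rpow, ENNReal.toReal_ofReal (by positivity)]
    rw [eL, eR, hlc] at hreal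
    -- `hreal : l/2 * δ₁ * (R³ V₁) * Av ≤ CDG R⁴ * ((C l² R³)^{1/2} * Ev^{1/2})`
    have hL0 : 0 ≤ l / 2 * δ₁ * (R ^ 3 * V₁) * Av := by positivity
    have hsq := pow_le_pow_left₀ hL0 hreal 2
    have hx1 : ((C * l ^ 2 * R ^ 3) ^ (1 / 2 : ℝ)) ^ 2 = C * l ^ 2 * R ^ 3 := by
      rw [← Real.rpow_two, ← Real.rpow_mul (by positivity)]; norm_num
    have hx2 : (Ev ^ (1 / 2 : ℝ)) ^ 2 = Ev := by
      rw [← Real.rpow_two, ← Real.rpow_mul hEv0]; norm_num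
    have hxR : (CDG * R ^ 4 * ((C * l ^ 2 * R ^ 3) ^ (1 / 2 : ℝ) * Ev ^ (1 / 2 : ℝ))) ^ 2 =
        CDG ^ 2 * R ^ 8 * (C * l ^ 2 * R ^ 3) * Ev := by
      rw [mul_pow, mul_pow, mul_pow, hx1, hx2]; ring
    rw [hxR] at hsq
    -- `hsq : (l/2 δ₁ R³ V₁ Av)² ≤ CDG² R⁸ (C l² R³) Ev`
    have hden : 0 < (l / 2 * δ₁ * (R ^ 3 * V₁)) ^ 2 := by positivity
    have hAv2 : Av ^ 2 =
        (l / 2 * δ₁ * (R ^ 3 * V₁) * Av) ^ 2 / (l / 2 * δ₁ * (R ^ 3 * V₁)) ^ 2 := by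
      rw [mul_pow (l / 2 * δ₁ * (R ^ 3 * V₁)) Av 2, mul_div_cancel_left₀ _ hden.ne']
    rw [hAv2, div_le_iff₀ hden]
    refine hsq.trans (le_of_eq ?_)
    have hδ₁0 : δ₁ ≠ 0 := hδ₁.ne'
    have hV₁0 : V₁ ≠ 0 := hV₁pos.ne'
    rw [hK2]
    field_simp
    ring
  -- ### summation over the levels `m < s`
  -- `|Q ∩ {Φ < k_{s+1}}| ≤ |A_{m+2}|` for `m < s`
  have hmono : ∀ m, m < s →
      (volume (Q ∩ {z | Φ z.1 z.2 < k₀ / 2 ^ (s + 1)})).toReal ≤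
        (volume (A (m + 1 + 1))).toReal := by
    intro m hm
    refine ENNReal.toReal_mono (hQfin' _).ne (measure_mono fun z hz => ⟨hz.1, ?_⟩)
    have h1 : Φ z.1 z.2 < k (s + 1) := hz.2
    exact h1.le.trans (hkanti (by omega))
  -- the bands are pairwise disjoint and null-measurable for `volume|Q`
  set S : ℕ → Set (ℝ × EuclideanSpace ℝ (Fin 3)) :=
    fun m => {z | k (m + 1) < Φ z.1 z.2 ∧ Φ z.1 z.2 < k m} with hS
  have hSnm : ∀ m, NullMeasurableSet (S m) (volume.restrict Q) := fun m =>
    hΦm'.nullMeasurable (measurableSet_Ioo (a := k (m + 1)) (b := k m))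
  have hES : ∀ m, volume (E m) = volume.restrict Q (S m) := fun m => by
    rw [Measure.restrict_apply₀ (hSnm m), inter_comm]
  have hdisj : Set.Pairwise (↑(Finset.range s) : Set ℕ) (Disjoint on fun m => S (m + 1)) := by
    intro m _ n _ hmn
    rcases lt_or_gt_of_ne hmn with hlt | hlt
    · refine disjoint_left.2 fun z hzm hzn => ?_
      have h1 : Φ z.1 z.2 < k (n + 1) := hzn.2
      have h2 : k (m + 1 + 1) < Φ z.1 z.2 := hzm.1
      have h3 : k (n + 1) ≤ k (m + 1 + 1) := hkanti (by omega)
      linarith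
    · refine disjoint_left.2 fun z hzm hzn => ?_
      have h1 : Φ z.1 z.2 < k (m + 1) := hzm.2
      have h2 : k (n + 1 + 1) < Φ z.1 z.2 := hzn.1
      have h3 : k (m + 1) ≤ k (n + 1 + 1) := hkanti (by omega)
      linarith
  have hsumE : ∑ m ∈ Finset.range s, volume (E (m + 1)) ≤ volume Q := by
    simp_rw [hES]
    rw [← measure_biUnion_finset₀ (fun m hm n hn hmn => (hdisj hm hn hmn).aedisjoint)
      (fun m _ => hSnm (m + 1))]
    calc volume.restrict Q (⋃ m ∈ Finset.range s, S (m + 1))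
        ≤ volume.restrict Q univ := measure_mono (subset_univ _)
      _ = volume Q := Measure.restrict_apply_univ _
  have hsumE' : ∑ m ∈ Finset.range s, (volume (E (m + 1))).toReal ≤ (volume Q).toReal := by
    rw [← ENNReal.toReal_sum (fun m _ => (hQfin' _).ne)]
    exact ENNReal.toReal_mono hQfin.ne hsumE
  -- assemble
  calc (s : ℝ) * (volume (Q ∩ {z | Φ z.1 z.2 < k₀ / 2 ^ (s + 1)})).toReal ^ 2
      = ∑ m ∈ Finset.range s, (volume (Q ∩ {z | Φ z.1 z.2 < k₀ / 2 ^ (s + 1)})).toReal ^ 2 := by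
        rw [Finset.sum_const, Finset.card_range, nsmul_eq_mul]
    _ ≤ ∑ m ∈ Finset.range s, (volume (A (m + 1 + 1))).toReal ^ 2 := by
        refine Finset.sum_le_sum fun m hm => ?_
        exact pow_le_pow_left₀ ENNReal.toReal_nonneg (hmono m (Finset.mem_range.1 hm)) 2
    _ ≤ ∑ m ∈ Finset.range s, K2 * (volume (E (m + 1))).toReal :=
        Finset.sum_le_sum fun m _ => key (m + 1) (by omega)
    _ = K2 * ∑ m ∈ Finset.range s, (volume (E (m + 1))).toReal := by rw [Finset.mul_sum]
    _ ≤ K2 * (volume Q).toReal := mul_le_mul_of_nonneg_left hsumE' hK2nn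
    _ = 4 * (64 * Real.pi / 3) ^ 2 * C * R ^ 5 /
          (δ₁ ^ 2 * (volume (ball (0 : EuclideanSpace ℝ (Fin 3)) 1)).toReal ^ 2) *
        (volume (Ioo a b ×ˢ ball x₀ R)).toReal := by rw [hK2]

/-- **Nazarov–Uraltseva 2012, Lemma 3.3 (shrinking levels), as printed.** In the setting of
`shrinkingLevels_sq_mul_le` (cylinder `Q = ]a, b[ × B_R(x₀)`, slices `C¹` off the axis, (3.11)
with `δ₁` for a.e. `t`, (3.12) with `C` for the levels `k_m = k₀/2^m`, `m ≥ 1`): for every `μ > 0`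
and every `s ≥ 4 C_DG² C R² / (δ₁² μ² (b - a) |B₁|³)`, `s ≥ 1` — a number depending only on `C`,
`δ₁`, `μ` and the aspect ratio `(b - a)/R²` of the cylinder ("`s` is completely determined by `n`,
`ν`, `λ`, `θ`, `μ`, `δ₁`, `q`, `ℓ`, `𝒩̂`") — one has `|Q ∩ {Φ < 2^{-(s+1)} k₀}| ≤ μ |Q|`.
[cite: NazarovUraltseva2012, Lemma 3.3; Seregin2020, Lemma 2.2] -/
theorem shrinkingLevels_measure_le_of_lipschitz
    (Φ : ℝ → EuclideanSpace ℝ (Fin 3) → ℝ) (x₀ : EuclideanSpace ℝ (Fin 3))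
    (R a b k₀ δ₁ C : ℝ) (hR : 0 < R) (hab : a < b) (hk₀ : 0 < k₀) (hδ₁ : 0 < δ₁) (hC : 0 ≤ C)
    (hΦm : AEStronglyMeasurable (uncurry Φ) (volume.restrict (Ioo a b ×ˢ ball x₀ R)))
    (hDm : AEStronglyMeasurable (fun z : ℝ × EuclideanSpace ℝ (Fin 3) => fderiv ℝ (Φ z.1) z.2)
      (volume.restrict (Ioo a b ×ˢ ball x₀ R)))
    {L : ℝ≥0} (hLip : ∀ t, LipschitzWith L (Φ t))
    (hδ : ∀ᵐ t ∂(volume.restrict (Ioo a b)), ENNReal.ofReal δ₁ * volume (ball x₀ R) ≤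
      volume (ball x₀ R ∩ {x | k₀ ≤ Φ t x}))
    (hE : ∀ m : ℕ, 1 ≤ m → ∫⁻ z in (Ioo a b ×ˢ ball x₀ R) ∩ {z | Φ z.1 z.2 < k₀ / 2 ^ m},
        ‖fderiv ℝ (Φ z.1) z.2‖ₑ ^ 2 ≤ ENNReal.ofReal (C * (k₀ / 2 ^ m) ^ 2 * R ^ 3))
    {μ : ℝ} (hμ : 0 < μ) {s : ℕ} (hs : 0 < s)
    (hsK : 4 * (64 * Real.pi / 3) ^ 2 * C * R ^ 2 /
        (δ₁ ^ 2 * μ ^ 2 * (b - a) * (volume (ball (0 : EuclideanSpace ℝ (Fin 3)) 1)).toReal ^ 3)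
          ≤ s) :
    volume ((Ioo a b ×ˢ ball x₀ R) ∩ {z | Φ z.1 z.2 < k₀ / 2 ^ (s + 1)}) ≤
      ENNReal.ofReal μ * volume (Ioo a b ×ˢ ball x₀ R) := by
  have hmain := shrinkingLevels_sq_mul_le_of_lipschitz Φ x₀ R a b k₀ δ₁ C hR hk₀ hδ₁ hC hΦm hDm hLip hδ hE s
  set Q : Set (ℝ × EuclideanSpace ℝ (Fin 3)) := Ioo a b ×ˢ ball x₀ R with hQ
  set V₁ : ℝ := (volume (ball (0 : EuclideanSpace ℝ (Fin 3)) 1)).toReal with hV₁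
  set CDG : ℝ := 64 * Real.pi / 3 with hCDG
  have hB1pos : 0 < volume (ball (0 : EuclideanSpace ℝ (Fin 3)) 1) := measure_ball_pos _ _ one_pos
  have hB1fin : volume (ball (0 : EuclideanSpace ℝ (Fin 3)) 1) < ∞ := measure_ball_lt_top
  have hV₁pos : 0 < V₁ := ENNReal.toReal_pos hB1pos.ne' hB1fin.ne
  have hQvol : volume Q = ENNReal.ofReal (b - a) * (ENNReal.ofReal (R ^ 3) *
      volume (ball (0 : EuclideanSpace ℝ (Fin 3)) 1)) := by
    rw [hQ, Measure.volume_eq_prod, Measure.prod_prod, Real.volume_Ioo,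
      Measure.addHaar_ball_of_pos volume x₀ hR, finrank_euclideanSpace_fin]
  have hQfin : volume Q < ∞ := by
    rw [hQvol]
    exact ENNReal.mul_lt_top ENNReal.ofReal_lt_top
      (ENNReal.mul_lt_top ENNReal.ofReal_lt_top hB1fin)
  have hXfin : volume (Q ∩ {z | Φ z.1 z.2 < k₀ / 2 ^ (s + 1)}) < ∞ :=
    (measure_mono inter_subset_left).trans_lt hQfin
  set V : ℝ := (volume Q).toReal with hV
  set X : ℝ := (volume (Q ∩ {z | Φ z.1 z.2 < k₀ / 2 ^ (s + 1)})).toReal with hX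
  have hVeq : V = (b - a) * (R ^ 3 * V₁) := by
    rw [hV, hQvol, ENNReal.toReal_mul, ENNReal.toReal_mul, ENNReal.toReal_ofReal (by linarith),
      ENNReal.toReal_ofReal (by positivity)]
  have hX0 : 0 ≤ X := ENNReal.toReal_nonneg
  have hV0 : 0 ≤ V := ENNReal.toReal_nonneg
  have hba : 0 < b - a := by linarith
  -- `hmain : s X² ≤ K₂ V`, and `K₂ V ≤ s μ² V²` by the choice of `s`
  have hden : 0 < δ₁ ^ 2 * μ ^ 2 * (b - a) * V₁ ^ 3 := by positivity
  have hsK' : 4 * CDG ^ 2 * C * R ^ 2 ≤ s * (δ₁ ^ 2 * μ ^ 2 * (b - a) * V₁ ^ 3) := by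
    rwa [hCDG, ← div_le_iff₀ hden]
  have hδ₁0 : δ₁ ≠ 0 := hδ₁.ne'
  have hV₁0 : V₁ ≠ 0 := hV₁pos.ne'
  have hKV : 4 * CDG ^ 2 * C * R ^ 5 / (δ₁ ^ 2 * V₁ ^ 2) * V ≤ s * (μ ^ 2 * V ^ 2) := by
    calc 4 * CDG ^ 2 * C * R ^ 5 / (δ₁ ^ 2 * V₁ ^ 2) * V
        = 4 * CDG ^ 2 * C * R ^ 2 * (R ^ 6 * (b - a) / (δ₁ ^ 2 * V₁)) := by
          rw [hVeq]; field_simp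
      _ ≤ s * (δ₁ ^ 2 * μ ^ 2 * (b - a) * V₁ ^ 3) * (R ^ 6 * (b - a) / (δ₁ ^ 2 * V₁)) :=
          mul_le_mul_of_nonneg_right hsK' (by positivity)
      _ = s * (μ ^ 2 * V ^ 2) := by
          rw [hVeq]; field_simp
  have h1 : (s : ℝ) * X ^ 2 ≤ s * (μ ^ 2 * V ^ 2) := hmain.trans hKV
  have hs' : (0 : ℝ) < s := by exact_mod_cast hs
  have h2 : X ^ 2 ≤ (μ * V) ^ 2 := by
    rw [mul_pow]; exact le_of_mul_le_mul_left h1 hs'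
  have h3 : X ≤ μ * V := (pow_le_pow_iff_left₀ hX0 (by positivity) two_ne_zero).1 h2
  calc volume (Q ∩ {z | Φ z.1 z.2 < k₀ / 2 ^ (s + 1)}) = ENNReal.ofReal X := by
        rw [hX, ENNReal.ofReal_toReal hXfin.ne]
    _ ≤ ENNReal.ofReal (μ * V) := ENNReal.ofReal_le_ofReal h3
    _ = ENNReal.ofReal μ * volume Q := by
        rw [ENNReal.ofReal_mul hμ.le, hV, ENNReal.ofReal_toReal hQfin.ne]

end Summit.NavierStokesRegularity.NavierStokesRegularity.Theorems.AveragedConeLiouville.NU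

end
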